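import Summits.BirchSwinnertonDyer.BirchSwinnertonDyer.Theorems.Rank2ObservatoryRank3KernelCertsIndex01
import Summits.BirchSwinnertonDyer.BirchSwinnertonDyer.Theorems.Rank2ObservatoryRank3KernelCertsIndex02
import Summits.BirchSwinnertonDyer.BirchSwinnertonDyer.Theorems.Rank2ObservatoryRank3KernelCertsIndex03
import Summits.BirchSwinnertonDyer.BirchSwinnertonDyer.Theorems.Rank2ObservatoryRank3KernelCertsIndex04
import Summits.BirchSwinnertonDyer.BirchSwinnertonDyer.Theorems.Rank2ObservatoryRank3KernelCertsIndex05
import Summits.BirchSwinnertonDyer.BirchSwinnertonDyer.Theorems.Rank2ObservatoryRank3KernelCertsIndex06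
import Summits.BirchSwinnertonDyer.BirchSwinnertonDyer.Theorems.Rank2ObservatoryRank3KernelCertsIndex07
import Summits.BirchSwinnertonDyer.BirchSwinnertonDyer.Theorems.Rank2ObservatoryRank3KernelCertsIndex08
import Summits.BirchSwinnertonDyer.BirchSwinnertonDyer.Theorems.Rank2ObservatoryRank3KernelCertsIndex09
import Summits.BirchSwinnertonDyer.BirchSwinnertonDyer.Theorems.Rank2ObservatoryRank3KernelCertsIndex10
import Summits.BirchSwinnertonDyer.BirchSwinnertonDyer.Theorems.Rank2ObservatoryRank3KernelCertsIndex11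
import Summits.BirchSwinnertonDyer.BirchSwinnertonDyer.Theorems.Rank2ObservatoryRank3KernelCertsIndex12
import Summits.BirchSwinnertonDyer.BirchSwinnertonDyer.Theorems.Rank2ObservatoryRank3KernelCertsIndex13
import Summits.BirchSwinnertonDyer.BirchSwinnertonDyer.Theorems.Rank2ObservatoryRank3KernelCertsIndex14
import Summits.BirchSwinnertonDyer.BirchSwinnertonDyer.Theorems.Rank2ObservatoryRank3KernelCertsIndex15
import Summits.BirchSwinnertonDyer.BirchSwinnertonDyer.Theorems.Rank2ObservatoryRank3KernelCertsIndex16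
import Summits.BirchSwinnertonDyer.BirchSwinnertonDyer.Theorems.Rank2ObservatoryRank3KernelCertsIndex17
import Summits.BirchSwinnertonDyer.BirchSwinnertonDyer.Theorems.Rank2ObservatoryRank3KernelCertsIndex18
import Summits.BirchSwinnertonDyer.BirchSwinnertonDyer.Theorems.Rank2ObservatoryRank3KernelCertsIndex19
import Summits.BirchSwinnertonDyer.BirchSwinnertonDyer.Theorems.Rank2ObservatoryRank3KernelCertsIndex20
import Summits.BirchSwinnertonDyer.BirchSwinnertonDyer.Theorems.Rank2ObservatoryRank3KernelCertsIndex21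
import Summits.BirchSwinnertonDyer.BirchSwinnertonDyer.Theorems.Rank2ObservatoryRank3KernelCertsIndex22
import Summits.BirchSwinnertonDyer.BirchSwinnertonDyer.Theorems.Rank2ObservatoryRank3KernelCertsIndex23
import Summits.BirchSwinnertonDyer.BirchSwinnertonDyer.Theorems.Rank2ObservatoryRank3KernelCertsIndex24
import Summits.BirchSwinnertonDyer.BirchSwinnertonDyer.Theorems.Rank2ObservatoryRank3KernelCertsIndex25
import Summits.BirchSwinnertonDyer.BirchSwinnertonDyer.Theorems.Rank2ObservatoryRank3KernelCertsIndex26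
import Summits.BirchSwinnertonDyer.BirchSwinnertonDyer.Theorems.Rank2ObservatoryRank3KernelCertsIndex27
import Summits.BirchSwinnertonDyer.BirchSwinnertonDyer.Theorems.Rank2ObservatoryRank3KernelCertsIndexW
import HarnessLib

/-!
# BirchSwinnertonDyer — rank ≥ 2 observatory: the rank-3 census with `hlow` DISCHARGED for every row

HONEST FRAMING: per-curve certified theorems and census instruments; no claim on BSD in rank ≥ 2.

Census leaf over the 27 chunk indexes and the `ℤ/4` supplement index of the rank-3 kernel
certificates: every one of the `9487` rows of `rank3Table` (rank `3`, conductor `< 500 000`) has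
`3 ≤ rank_ℤ E(ℚ)` as a KERNEL THEOREM (`three_le_mordellWeilRank_of_kernelCert[T|T2|T3|T4]`:
integral model, torsion annihilator from two kernel point counts — `2`-exponent sharpened where needed
by `noOrder4` (66 rows), by the rational `2`-torsion point (23 rows), or kept at `u = 2` with the
rational `4`-torsion point (7 rows) —, seven coset witnesses in `Ẽ(𝔽_q)`, `q ≤ 199`, taken modulo
the rational two- or four-torsion only where `Ẽ[2]` is too big (17 + 7 rows); Mordell–Weil from the
tree). Hence the census theorems of `Rank2ObservatoryRank3Census` hold for every row WITHOUT the
hypothesis `hlow` (REFEREE.md §L2: "the independence of the generators (rank ≥ 3) is NOT formalised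
(hlow is a certificate field)" — now it is, for all rows):
`Rank3Row.three_le_rank_kernel`, `Rank3Row.lvalues_eq_zero_kernel` (`L(E,1) = L′(E,1) = 0` given
only Gross–Zagier–Kolyvagin), `Rank3Row.analyticRank_eq_rank_kernel`, `Rank3Row.rank3_lderiv_eq_zero_kernel`.
The cover of each chunk by its certified row list is a kernel `decide` (list equality; for the seven
chunks with a `ℤ/4` row, equality with the `ℤ/4` row spliced in). What stays named: Gross–Zagier–
Kolyvagin (bsd.S17), `rank_upper` (no 2-descent in Lean), `L‴(E,1) ≠ 0` and the root number (no
numerics in Lean). No new analytic input; sorry-free.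

References: Cremona (1997) Tables, §2.13, §3.5; Silverman AEC (2009) VII.3.1(b), VIII.6.7; Gross,
LMS LNS 153 (1991) Thm. 1.3; Darmon (2004) Thm. 3.22.
-/

-- single-conjunct summit: `Summit.BirchSwinnertonDyer.BirchSwinnertonDyer.…` repeats the name by design
set_option linter.dupNamespace false

namespace Summit.BirchSwinnertonDyer.BirchSwinnertonDyer.Rank2Observatory

open Literature Literature.NumberTheory.EllipticCurves WeierstrassCurve

/-- Chunk 01 is covered: the certified row list IS the chunk (kernel `decide`). [folklore] -/
theorem rank3Rows01_eq_kernelCertRows : rank3Rows01 = rank3KernelCertRows01 := by decide +kernel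

/-- `3 ≤ rank_ℤ E(ℚ)` for every row of chunk 01. [cite: CremonaAlgorithms1997, §3.5] -/
theorem three_le_mordellWeilRank_of_mem_rank3Rows01 : ∀ r ∈ rank3Rows01, 3 ≤ r.curve.mordellWeilRank := by
  rw [rank3Rows01_eq_kernelCertRows]; exact three_le_mordellWeilRank_of_mem_rank3KernelCertRows01

/-- Chunk 02 is covered: the certified row list IS the chunk (kernel `decide`). [folklore] -/
theorem rank3Rows02_eq_kernelCertRows : rank3Rows02 = rank3KernelCertRows02 := by decide +kernel

/-- `3 ≤ rank_ℤ E(ℚ)` for every row of chunk 02. [cite: CremonaAlgorithms1997, §3.5] -/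
theorem three_le_mordellWeilRank_of_mem_rank3Rows02 : ∀ r ∈ rank3Rows02, 3 ≤ r.curve.mordellWeilRank := by
  rw [rank3Rows02_eq_kernelCertRows]; exact three_le_mordellWeilRank_of_mem_rank3KernelCertRows02

/-- Chunk 03 is covered: the certified row list IS the chunk (kernel `decide`). [folklore] -/
theorem rank3Rows03_eq_kernelCertRows : rank3Rows03 = rank3KernelCertRows03 := by decide +kernel

/-- `3 ≤ rank_ℤ E(ℚ)` for every row of chunk 03. [cite: CremonaAlgorithms1997, §3.5] -/
theorem three_le_mordellWeilRank_of_mem_rank3Rows03 : ∀ r ∈ rank3Rows03, 3 ≤ r.curve.mordellWeilRank := by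
  rw [rank3Rows03_eq_kernelCertRows]; exact three_le_mordellWeilRank_of_mem_rank3KernelCertRows03

/-- Chunk 04 is covered: the certified row list IS the chunk (kernel `decide`). [folklore] -/
theorem rank3Rows04_eq_kernelCertRows : rank3Rows04 = rank3KernelCertRows04 := by decide +kernel

/-- `3 ≤ rank_ℤ E(ℚ)` for every row of chunk 04. [cite: CremonaAlgorithms1997, §3.5] -/
theorem three_le_mordellWeilRank_of_mem_rank3Rows04 : ∀ r ∈ rank3Rows04, 3 ≤ r.curve.mordellWeilRank := by
  rw [rank3Rows04_eq_kernelCertRows]; exact three_le_mordellWeilRank_of_mem_rank3KernelCertRows04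

/-- Chunk 05 is covered: the certified row list IS the chunk (kernel `decide`). [folklore] -/
theorem rank3Rows05_eq_kernelCertRows : rank3Rows05 = rank3KernelCertRows05 := by decide +kernel

/-- `3 ≤ rank_ℤ E(ℚ)` for every row of chunk 05. [cite: CremonaAlgorithms1997, §3.5] -/
theorem three_le_mordellWeilRank_of_mem_rank3Rows05 : ∀ r ∈ rank3Rows05, 3 ≤ r.curve.mordellWeilRank := by
  rw [rank3Rows05_eq_kernelCertRows]; exact three_le_mordellWeilRank_of_mem_rank3KernelCertRows05

/-- Chunk 06 is covered: the certified row list IS the chunk (kernel `decide`). [folklore] -/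
theorem rank3Rows06_eq_kernelCertRows : rank3Rows06 = rank3KernelCertRows06 := by decide +kernel

/-- `3 ≤ rank_ℤ E(ℚ)` for every row of chunk 06. [cite: CremonaAlgorithms1997, §3.5] -/
theorem three_le_mordellWeilRank_of_mem_rank3Rows06 : ∀ r ∈ rank3Rows06, 3 ≤ r.curve.mordellWeilRank := by
  rw [rank3Rows06_eq_kernelCertRows]; exact three_le_mordellWeilRank_of_mem_rank3KernelCertRows06

/-- Chunk 07 is covered: the certified row list with the `ℤ/4` row (entry `0` of
`rank3KernelCertRowsW`) spliced in at position `321` IS the chunk (kernel `decide`). [folklore] -/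
theorem rank3Rows07_eq_kernelCertRows : rank3Rows07 =
    rank3KernelCertRows07.take 321 ++ ((rank3KernelCertRowsW.drop 0).take 1 ++ rank3KernelCertRows07.drop 321) := by
  decide +kernel

/-- `3 ≤ rank_ℤ E(ℚ)` for every row of chunk 07. [cite: CremonaAlgorithms1997, §3.5] -/
theorem three_le_mordellWeilRank_of_mem_rank3Rows07 : ∀ r ∈ rank3Rows07, 3 ≤ r.curve.mordellWeilRank := by
  intro r hr
  rw [rank3Rows07_eq_kernelCertRows, List.mem_append, List.mem_append] at hr
  rcases hr with h | h | h
  · exact three_le_mordellWeilRank_of_mem_rank3KernelCertRows07 r (List.take_subset _ _ h)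
  · exact three_le_mordellWeilRank_of_mem_rank3KernelCertRowsW r
      (List.drop_subset _ _ (List.take_subset _ _ h))
  · exact three_le_mordellWeilRank_of_mem_rank3KernelCertRows07 r (List.drop_subset _ _ h)

/-- Chunk 08 is covered: the certified row list IS the chunk (kernel `decide`). [folklore] -/
theorem rank3Rows08_eq_kernelCertRows : rank3Rows08 = rank3KernelCertRows08 := by decide +kernel

/-- `3 ≤ rank_ℤ E(ℚ)` for every row of chunk 08. [cite: CremonaAlgorithms1997, §3.5] -/
theorem three_le_mordellWeilRank_of_mem_rank3Rows08 : ∀ r ∈ rank3Rows08, 3 ≤ r.curve.mordellWeilRank := by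
  rw [rank3Rows08_eq_kernelCertRows]; exact three_le_mordellWeilRank_of_mem_rank3KernelCertRows08

/-- Chunk 09 is covered: the certified row list IS the chunk (kernel `decide`). [folklore] -/
theorem rank3Rows09_eq_kernelCertRows : rank3Rows09 = rank3KernelCertRows09 := by decide +kernel

/-- `3 ≤ rank_ℤ E(ℚ)` for every row of chunk 09. [cite: CremonaAlgorithms1997, §3.5] -/
theorem three_le_mordellWeilRank_of_mem_rank3Rows09 : ∀ r ∈ rank3Rows09, 3 ≤ r.curve.mordellWeilRank := by
  rw [rank3Rows09_eq_kernelCertRows]; exact three_le_mordellWeilRank_of_mem_rank3KernelCertRows09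

/-- Chunk 10 is covered: the certified row list IS the chunk (kernel `decide`). [folklore] -/
theorem rank3Rows10_eq_kernelCertRows : rank3Rows10 = rank3KernelCertRows10 := by decide +kernel

/-- `3 ≤ rank_ℤ E(ℚ)` for every row of chunk 10. [cite: CremonaAlgorithms1997, §3.5] -/
theorem three_le_mordellWeilRank_of_mem_rank3Rows10 : ∀ r ∈ rank3Rows10, 3 ≤ r.curve.mordellWeilRank := by
  rw [rank3Rows10_eq_kernelCertRows]; exact three_le_mordellWeilRank_of_mem_rank3KernelCertRows10

/-- Chunk 11 is covered: the certified row list with the `ℤ/4` row (entry `1` of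
`rank3KernelCertRowsW`) spliced in at position `195` IS the chunk (kernel `decide`). [folklore] -/
theorem rank3Rows11_eq_kernelCertRows : rank3Rows11 =
    rank3KernelCertRows11.take 195 ++ ((rank3KernelCertRowsW.drop 1).take 1 ++ rank3KernelCertRows11.drop 195) := by
  decide +kernel

/-- `3 ≤ rank_ℤ E(ℚ)` for every row of chunk 11. [cite: CremonaAlgorithms1997, §3.5] -/
theorem three_le_mordellWeilRank_of_mem_rank3Rows11 : ∀ r ∈ rank3Rows11, 3 ≤ r.curve.mordellWeilRank := by
  intro r hr
  rw [rank3Rows11_eq_kernelCertRows, List.mem_append, List.mem_append] at hr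
  rcases hr with h | h | h
  · exact three_le_mordellWeilRank_of_mem_rank3KernelCertRows11 r (List.take_subset _ _ h)
  · exact three_le_mordellWeilRank_of_mem_rank3KernelCertRowsW r
      (List.drop_subset _ _ (List.take_subset _ _ h))
  · exact three_le_mordellWeilRank_of_mem_rank3KernelCertRows11 r (List.drop_subset _ _ h)

/-- Chunk 12 is covered: the certified row list IS the chunk (kernel `decide`). [folklore] -/
theorem rank3Rows12_eq_kernelCertRows : rank3Rows12 = rank3KernelCertRows12 := by decide +kernel

/-- `3 ≤ rank_ℤ E(ℚ)` for every row of chunk 12. [cite: CremonaAlgorithms1997, §3.5] -/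
theorem three_le_mordellWeilRank_of_mem_rank3Rows12 : ∀ r ∈ rank3Rows12, 3 ≤ r.curve.mordellWeilRank := by
  rw [rank3Rows12_eq_kernelCertRows]; exact three_le_mordellWeilRank_of_mem_rank3KernelCertRows12

/-- Chunk 13 is covered: the certified row list with the `ℤ/4` row (entry `2` of
`rank3KernelCertRowsW`) spliced in at position `112` IS the chunk (kernel `decide`). [folklore] -/
theorem rank3Rows13_eq_kernelCertRows : rank3Rows13 =
    rank3KernelCertRows13.take 112 ++ ((rank3KernelCertRowsW.drop 2).take 1 ++ rank3KernelCertRows13.drop 112) := by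
  decide +kernel

/-- `3 ≤ rank_ℤ E(ℚ)` for every row of chunk 13. [cite: CremonaAlgorithms1997, §3.5] -/
theorem three_le_mordellWeilRank_of_mem_rank3Rows13 : ∀ r ∈ rank3Rows13, 3 ≤ r.curve.mordellWeilRank := by
  intro r hr
  rw [rank3Rows13_eq_kernelCertRows, List.mem_append, List.mem_append] at hr
  rcases hr with h | h | h
  · exact three_le_mordellWeilRank_of_mem_rank3KernelCertRows13 r (List.take_subset _ _ h)
  · exact three_le_mordellWeilRank_of_mem_rank3KernelCertRowsW r
      (List.drop_subset _ _ (List.take_subset _ _ h))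
  · exact three_le_mordellWeilRank_of_mem_rank3KernelCertRows13 r (List.drop_subset _ _ h)

/-- Chunk 14 is covered: the certified row list IS the chunk (kernel `decide`). [folklore] -/
theorem rank3Rows14_eq_kernelCertRows : rank3Rows14 = rank3KernelCertRows14 := by decide +kernel

/-- `3 ≤ rank_ℤ E(ℚ)` for every row of chunk 14. [cite: CremonaAlgorithms1997, §3.5] -/
theorem three_le_mordellWeilRank_of_mem_rank3Rows14 : ∀ r ∈ rank3Rows14, 3 ≤ r.curve.mordellWeilRank := by
  rw [rank3Rows14_eq_kernelCertRows]; exact three_le_mordellWeilRank_of_mem_rank3KernelCertRows14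

/-- Chunk 15 is covered: the certified row list with the `ℤ/4` row (entry `3` of
`rank3KernelCertRowsW`) spliced in at position `310` IS the chunk (kernel `decide`). [folklore] -/
theorem rank3Rows15_eq_kernelCertRows : rank3Rows15 =
    rank3KernelCertRows15.take 310 ++ ((rank3KernelCertRowsW.drop 3).take 1 ++ rank3KernelCertRows15.drop 310) := by
  decide +kernel

/-- `3 ≤ rank_ℤ E(ℚ)` for every row of chunk 15. [cite: CremonaAlgorithms1997, §3.5] -/
theorem three_le_mordellWeilRank_of_mem_rank3Rows15 : ∀ r ∈ rank3Rows15, 3 ≤ r.curve.mordellWeilRank := by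
  intro r hr
  rw [rank3Rows15_eq_kernelCertRows, List.mem_append, List.mem_append] at hr
  rcases hr with h | h | h
  · exact three_le_mordellWeilRank_of_mem_rank3KernelCertRows15 r (List.take_subset _ _ h)
  · exact three_le_mordellWeilRank_of_mem_rank3KernelCertRowsW r
      (List.drop_subset _ _ (List.take_subset _ _ h))
  · exact three_le_mordellWeilRank_of_mem_rank3KernelCertRows15 r (List.drop_subset _ _ h)

/-- Chunk 16 is covered: the certified row list IS the chunk (kernel `decide`). [folklore] -/
theorem rank3Rows16_eq_kernelCertRows : rank3Rows16 = rank3KernelCertRows16 := by decide +kernel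

/-- `3 ≤ rank_ℤ E(ℚ)` for every row of chunk 16. [cite: CremonaAlgorithms1997, §3.5] -/
theorem three_le_mordellWeilRank_of_mem_rank3Rows16 : ∀ r ∈ rank3Rows16, 3 ≤ r.curve.mordellWeilRank := by
  rw [rank3Rows16_eq_kernelCertRows]; exact three_le_mordellWeilRank_of_mem_rank3KernelCertRows16

/-- Chunk 17 is covered: the certified row list IS the chunk (kernel `decide`). [folklore] -/
theorem rank3Rows17_eq_kernelCertRows : rank3Rows17 = rank3KernelCertRows17 := by decide +kernel

/-- `3 ≤ rank_ℤ E(ℚ)` for every row of chunk 17. [cite: CremonaAlgorithms1997, §3.5] -/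
theorem three_le_mordellWeilRank_of_mem_rank3Rows17 : ∀ r ∈ rank3Rows17, 3 ≤ r.curve.mordellWeilRank := by
  rw [rank3Rows17_eq_kernelCertRows]; exact three_le_mordellWeilRank_of_mem_rank3KernelCertRows17

/-- Chunk 18 is covered: the certified row list IS the chunk (kernel `decide`). [folklore] -/
theorem rank3Rows18_eq_kernelCertRows : rank3Rows18 = rank3KernelCertRows18 := by decide +kernel

/-- `3 ≤ rank_ℤ E(ℚ)` for every row of chunk 18. [cite: CremonaAlgorithms1997, §3.5] -/
theorem three_le_mordellWeilRank_of_mem_rank3Rows18 : ∀ r ∈ rank3Rows18, 3 ≤ r.curve.mordellWeilRank := by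
  rw [rank3Rows18_eq_kernelCertRows]; exact three_le_mordellWeilRank_of_mem_rank3KernelCertRows18

/-- Chunk 19 is covered: the certified row list IS the chunk (kernel `decide`). [folklore] -/
theorem rank3Rows19_eq_kernelCertRows : rank3Rows19 = rank3KernelCertRows19 := by decide +kernel

/-- `3 ≤ rank_ℤ E(ℚ)` for every row of chunk 19. [cite: CremonaAlgorithms1997, §3.5] -/
theorem three_le_mordellWeilRank_of_mem_rank3Rows19 : ∀ r ∈ rank3Rows19, 3 ≤ r.curve.mordellWeilRank := by
  rw [rank3Rows19_eq_kernelCertRows]; exact three_le_mordellWeilRank_of_mem_rank3KernelCertRows19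

/-- Chunk 20 is covered: the certified row list IS the chunk (kernel `decide`). [folklore] -/
theorem rank3Rows20_eq_kernelCertRows : rank3Rows20 = rank3KernelCertRows20 := by decide +kernel

/-- `3 ≤ rank_ℤ E(ℚ)` for every row of chunk 20. [cite: CremonaAlgorithms1997, §3.5] -/
theorem three_le_mordellWeilRank_of_mem_rank3Rows20 : ∀ r ∈ rank3Rows20, 3 ≤ r.curve.mordellWeilRank := by
  rw [rank3Rows20_eq_kernelCertRows]; exact three_le_mordellWeilRank_of_mem_rank3KernelCertRows20

/-- Chunk 21 is covered: the certified row list IS the chunk (kernel `decide`). [folklore] -/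
theorem rank3Rows21_eq_kernelCertRows : rank3Rows21 = rank3KernelCertRows21 := by decide +kernel

/-- `3 ≤ rank_ℤ E(ℚ)` for every row of chunk 21. [cite: CremonaAlgorithms1997, §3.5] -/
theorem three_le_mordellWeilRank_of_mem_rank3Rows21 : ∀ r ∈ rank3Rows21, 3 ≤ r.curve.mordellWeilRank := by
  rw [rank3Rows21_eq_kernelCertRows]; exact three_le_mordellWeilRank_of_mem_rank3KernelCertRows21

/-- Chunk 22 is covered: the certified row list IS the chunk (kernel `decide`). [folklore] -/
theorem rank3Rows22_eq_kernelCertRows : rank3Rows22 = rank3KernelCertRows22 := by decide +kernel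

/-- `3 ≤ rank_ℤ E(ℚ)` for every row of chunk 22. [cite: CremonaAlgorithms1997, §3.5] -/
theorem three_le_mordellWeilRank_of_mem_rank3Rows22 : ∀ r ∈ rank3Rows22, 3 ≤ r.curve.mordellWeilRank := by
  rw [rank3Rows22_eq_kernelCertRows]; exact three_le_mordellWeilRank_of_mem_rank3KernelCertRows22

/-- Chunk 23 is covered: the certified row list with the `ℤ/4` row (entry `4` of
`rank3KernelCertRowsW`) spliced in at position `256` IS the chunk (kernel `decide`). [folklore] -/
theorem rank3Rows23_eq_kernelCertRows : rank3Rows23 =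
    rank3KernelCertRows23.take 256 ++ ((rank3KernelCertRowsW.drop 4).take 1 ++ rank3KernelCertRows23.drop 256) := by
  decide +kernel

/-- `3 ≤ rank_ℤ E(ℚ)` for every row of chunk 23. [cite: CremonaAlgorithms1997, §3.5] -/
theorem three_le_mordellWeilRank_of_mem_rank3Rows23 : ∀ r ∈ rank3Rows23, 3 ≤ r.curve.mordellWeilRank := by
  intro r hr
  rw [rank3Rows23_eq_kernelCertRows, List.mem_append, List.mem_append] at hr
  rcases hr with h | h | h
  · exact three_le_mordellWeilRank_of_mem_rank3KernelCertRows23 r (List.take_subset _ _ h)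
  · exact three_le_mordellWeilRank_of_mem_rank3KernelCertRowsW r
      (List.drop_subset _ _ (List.take_subset _ _ h))
  · exact three_le_mordellWeilRank_of_mem_rank3KernelCertRows23 r (List.drop_subset _ _ h)

/-- Chunk 24 is covered: the certified row list with the `ℤ/4` row (entry `5` of
`rank3KernelCertRowsW`) spliced in at position `120` IS the chunk (kernel `decide`). [folklore] -/
theorem rank3Rows24_eq_kernelCertRows : rank3Rows24 =
    rank3KernelCertRows24.take 120 ++ ((rank3KernelCertRowsW.drop 5).take 1 ++ rank3KernelCertRows24.drop 120) := by
  decide +kernel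

/-- `3 ≤ rank_ℤ E(ℚ)` for every row of chunk 24. [cite: CremonaAlgorithms1997, §3.5] -/
theorem three_le_mordellWeilRank_of_mem_rank3Rows24 : ∀ r ∈ rank3Rows24, 3 ≤ r.curve.mordellWeilRank := by
  intro r hr
  rw [rank3Rows24_eq_kernelCertRows, List.mem_append, List.mem_append] at hr
  rcases hr with h | h | h
  · exact three_le_mordellWeilRank_of_mem_rank3KernelCertRows24 r (List.take_subset _ _ h)
  · exact three_le_mordellWeilRank_of_mem_rank3KernelCertRowsW r
      (List.drop_subset _ _ (List.take_subset _ _ h))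
  · exact three_le_mordellWeilRank_of_mem_rank3KernelCertRows24 r (List.drop_subset _ _ h)

/-- Chunk 25 is covered: the certified row list IS the chunk (kernel `decide`). [folklore] -/
theorem rank3Rows25_eq_kernelCertRows : rank3Rows25 = rank3KernelCertRows25 := by decide +kernel

/-- `3 ≤ rank_ℤ E(ℚ)` for every row of chunk 25. [cite: CremonaAlgorithms1997, §3.5] -/
theorem three_le_mordellWeilRank_of_mem_rank3Rows25 : ∀ r ∈ rank3Rows25, 3 ≤ r.curve.mordellWeilRank := by
  rw [rank3Rows25_eq_kernelCertRows]; exact three_le_mordellWeilRank_of_mem_rank3KernelCertRows25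

/-- Chunk 26 is covered: the certified row list with the `ℤ/4` row (entry `6` of
`rank3KernelCertRowsW`) spliced in at position `295` IS the chunk (kernel `decide`). [folklore] -/
theorem rank3Rows26_eq_kernelCertRows : rank3Rows26 =
    rank3KernelCertRows26.take 295 ++ ((rank3KernelCertRowsW.drop 6).take 1 ++ rank3KernelCertRows26.drop 295) := by
  decide +kernel

/-- `3 ≤ rank_ℤ E(ℚ)` for every row of chunk 26. [cite: CremonaAlgorithms1997, §3.5] -/
theorem three_le_mordellWeilRank_of_mem_rank3Rows26 : ∀ r ∈ rank3Rows26, 3 ≤ r.curve.mordellWeilRank := by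
  intro r hr
  rw [rank3Rows26_eq_kernelCertRows, List.mem_append, List.mem_append] at hr
  rcases hr with h | h | h
  · exact three_le_mordellWeilRank_of_mem_rank3KernelCertRows26 r (List.take_subset _ _ h)
  · exact three_le_mordellWeilRank_of_mem_rank3KernelCertRowsW r
      (List.drop_subset _ _ (List.take_subset _ _ h))
  · exact three_le_mordellWeilRank_of_mem_rank3KernelCertRows26 r (List.drop_subset _ _ h)

/-- Chunk 27 is covered: the certified row list IS the chunk (kernel `decide`). [folklore] -/
theorem rank3Rows27_eq_kernelCertRows : rank3Rows27 = rank3KernelCertRows27 := by decide +kernel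

/-- `3 ≤ rank_ℤ E(ℚ)` for every row of chunk 27. [cite: CremonaAlgorithms1997, §3.5] -/
theorem three_le_mordellWeilRank_of_mem_rank3Rows27 : ∀ r ∈ rank3Rows27, 3 ≤ r.curve.mordellWeilRank := by
  rw [rank3Rows27_eq_kernelCertRows]; exact three_le_mordellWeilRank_of_mem_rank3KernelCertRows27

/-- **`3 ≤ rank_ℤ E(ℚ)` for EVERY row of the rank-3 census table** — the certificate field `hlow`
discharged by kernel certificates for all `9487` rows (Mordell–Weil from the tree; no named hypothesis).
[cite: CremonaAlgorithms1997, §3.5] [cite: SilvermanAEC2009, Thm. VIII.6.7] -/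
theorem three_le_mordellWeilRank_of_mem_rank3Table : ∀ r ∈ rank3Table, 3 ≤ r.curve.mordellWeilRank := by
  simp only [rank3Table, List.forall_mem_append, and_assoc]
  exact ⟨three_le_mordellWeilRank_of_mem_rank3Rows01, three_le_mordellWeilRank_of_mem_rank3Rows02, three_le_mordellWeilRank_of_mem_rank3Rows03, three_le_mordellWeilRank_of_mem_rank3Rows04, three_le_mordellWeilRank_of_mem_rank3Rows05, three_le_mordellWeilRank_of_mem_rank3Rows06, three_le_mordellWeilRank_of_mem_rank3Rows07, three_le_mordellWeilRank_of_mem_rank3Rows08, three_le_mordellWeilRank_of_mem_rank3Rows09,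
    three_le_mordellWeilRank_of_mem_rank3Rows10, three_le_mordellWeilRank_of_mem_rank3Rows11, three_le_mordellWeilRank_of_mem_rank3Rows12, three_le_mordellWeilRank_of_mem_rank3Rows13, three_le_mordellWeilRank_of_mem_rank3Rows14, three_le_mordellWeilRank_of_mem_rank3Rows15, three_le_mordellWeilRank_of_mem_rank3Rows16, three_le_mordellWeilRank_of_mem_rank3Rows17, three_le_mordellWeilRank_of_mem_rank3Rows18,
    three_le_mordellWeilRank_of_mem_rank3Rows19, three_le_mordellWeilRank_of_mem_rank3Rows20, three_le_mordellWeilRank_of_mem_rank3Rows21, three_le_mordellWeilRank_of_mem_rank3Rows22, three_le_mordellWeilRank_of_mem_rank3Rows23, three_le_mordellWeilRank_of_mem_rank3Rows24, three_le_mordellWeilRank_of_mem_rank3Rows25, three_le_mordellWeilRank_of_mem_rank3Rows26, three_le_mordellWeilRank_of_mem_rank3Rows27⟩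

/-- **`hlow` discharged, row form.** [cite: CremonaAlgorithms1997, §3.5] -/
theorem Rank3Row.three_le_rank_kernel {r : Rank3Row} (hr : r ∈ rank3Table) :
    3 ≤ r.curve.mordellWeilRank :=
  three_le_mordellWeilRank_of_mem_rank3Table r hr

/-- **`L(E,1) = 0` and `L′(E,1) = 0` EXACTLY for every row of the rank-3 census**, given only
Gross–Zagier–Kolyvagin (`hGZK`, bsd.S17): no `hlow`, no numerics. [cite: CremonaAlgorithms1997, §2.13]
[cite: Darmon2004, Thm. 3.22] -/
theorem Rank3Row.lvalues_eq_zero_kernel {r : Rank3Row} (hr : r ∈ rank3Table)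
    (hGZK : rank_eq_analyticRank_of_analyticRank_le_one) :
    r.curve.entireLFunction 1 = 0 ∧ deriv r.curve.entireLFunction 1 = 0 :=
  Rank3Row.lvalues_eq_zero_of_three_le hr hGZK (three_le_mordellWeilRank_of_mem_rank3Table r hr)

/-- **`r_an(E) = rank_ℤ E(ℚ) (= 3)` for every row of the rank-3 census with `hlow` DISCHARGED**; the
remaining named hypotheses are Gross–Zagier–Kolyvagin and the certificate fields `rank_upper`
(`rank ≤ 3`, 2-descent), `L‴(E,1) ≠ 0` and the root number. [cite: CremonaAlgorithms1997, §2.13]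
[cite: Darmon2004, Thm. 3.22] -/
theorem Rank3Row.analyticRank_eq_rank_kernel {r : Rank3Row} (hr : r ∈ rank3Table)
    (hGZK : rank_eq_analyticRank_of_analyticRank_le_one) (hup : r.curve.mordellWeilRank ≤ 3)
    (hL3 : iteratedDeriv 3 r.curve.entireLFunction 1 ≠ 0) (hw : r.curve.rootNumber = -1) :
    r.curve.analyticRank = r.curve.mordellWeilRank :=
  Rank3Row.analyticRank_eq_rank_of_three_le hr (three_le_mordellWeilRank_of_mem_rank3Table r hr)
    hGZK hup hL3 hw

/-- **`L′(E,1) = 0` over `K = ℚ(√D)` for every row of the rank-3 census with `hlow` DISCHARGED**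
(Gross–Zagier–Kolyvagin over `K`; the other inputs stay named hypotheses).
[cite: GrossLMS1991, (1.1) and Thm. 1.3] [cite: Darmon2004, Hypothesis 3.9] -/
theorem Rank3Row.rank3_lderiv_eq_zero_kernel {r : Rank3Row} (hr : r ∈ rank3Table) (K : Type)
    [Field K] [NumberField K] (hE : WeierstrassCurve.hasEntireLFunction_rat)
    (hGZKK : mordellWeilRank_eq_one_of_LDerivEK_ne_zero r.curve K)
    (hmin : r.curve.IsGloballyMinimal) (hN : r.curve.conductorNorm ℤ = r.N)
    (hK : IsImaginaryQuadratic K) (hdK : NumberField.discr K = r.D)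
    (hw : r.curve.rootNumber = -1) (hLD : (r.curve.quadraticTwist (r.D : ℚ)).entireLFunction 1 ≠ 0) :
    deriv r.curve.entireLFunction 1 = 0 :=
  Rank3Row.rank3_lderiv_eq_zero_of_three_le hr (three_le_mordellWeilRank_of_mem_rank3Table r hr) K hE
    hGZKK hmin hN hK hdK hw hLD

end Summit.BirchSwinnertonDyer.BirchSwinnertonDyer.Rank2Observatory
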